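import Literature.Combinatorics.StablePolynomials.NegativeLatticeCondition
import HarnessLib

/-!
# Pairwise negative correlation for real stable multi-affine coefficient families

Topic `Literature/Combinatorics/StablePolynomials`; companion of `NegativeLatticeCondition.lean`.
For a REAL coefficient family `c : Finset σ → ℝ` whose generating polynomial `Σ_S c(S) z^S` is
identically zero or zero-free on the open upper half-space `H^σ` ("stable or zero" — the form in
which stability propagates through real specialisations), we prove the measure-level consequence
used throughout the theory of strongly Rayleigh measures (Borcea–Brändén–Liggett, *Negative
dependence and the geometry of polynomials*, JAMS 22 (2009), §2.1 and §4.1):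

* `multiAffine_pairwise_negCorr` — **pairwise negative correlation** in unnormalised form,
  `(Σ_{S ∋ x,y} c)(Σ_S c) ≤ (Σ_{S ∋ x} c)(Σ_{S ∋ y} c)` for `x ≠ y` (for a probability measure:
  `P(x,y ∈ S) ≤ P(x ∈ S) P(y ∈ S)`); no sign assumption on `c` is needed;
* `multiAffine_marginal_nlc` — the equivalent two-by-two negative lattice condition for the
  marginal table `m(A) = Σ_{S ∩ {x,y} = A} c(S)`: `m(∅) m({x,y}) ≤ m({x}) m({y})`.

Proof: specialise every variable other than `z_x, z_y` at the REAL value `1`; each specialisation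
keeps "stable or zero" (`multiAffine_stableOrZero_specialize`, from Wagner's Lemma 2.4 (d) =
the tree's `IsUpperHalfPlaneStable.specialize_real` transported to the coefficient form through
`bind₁_update_multiAffine`); the iterate along a list has the closed form
`S ↦ [S ∩ L = ∅] Σ_{U ⊆ L} c(S ∪ U)` (`foldr_specializeOne_apply`), which on `L = σ ∖ {x,y}` is the
marginal table; then `multiAffine_twoByTwo_nlc` of `NegativeLatticeCondition.lean`.

Written as input for void/emptiness bounds of amplitude-linear laws of strongly Rayleigh ground
states (crux `BECStronglyRayleigh.InsertionFieldDelocalisation`, stmt-AtomisticToContinuum-9673),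
but stated in full generality. Not here: negative association (BBL Thm. 4.9), anything normalised.

## Mathlib / tree search

REUSED: `multiAffine`, `eval_multiAffine`, `isUpperHalfPlaneStable_multiAffine_iff`,
`multiAffine_eq_zero_iff`, `IsUpperHalfPlaneStable.specialize_real`, `eval_bind₁_update`,
`multiAffine_twoByTwo_nlc` (tree); Mathlib `MvPolynomial.funext`, `Finset.sum_nbij'`.
-/

noncomputable section

namespace Literature.Combinatorics.StablePolynomials

open MvPolynomial Finset Filter Topology
open scoped BigOperators

variable {σ : Type*} [Fintype σ] [DecidableEq σ]

/-- **Specialising one variable of the coefficient form at a scalar**: substituting `z_j := w` in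
`Σ_S c(S) z^S` gives the multi-affine polynomial `Σ_{S ∌ j} (c(S) + w·c(S ∪ j)) z^S`. [folklore] -/
theorem bind₁_update_multiAffine (c : Finset σ → ℂ) (j : σ) (w : ℂ) :
    bind₁ (Function.update X j (C w)) (multiAffine c) =
      multiAffine (fun S => if j ∈ S then 0 else c S + w * c (insert j S)) := by
  classical
  apply MvPolynomial.funext
  intro z
  rw [eval_bind₁_update, eval_multiAffine, eval_multiAffine]
  -- split the left sum according to `j ∈ S`
  rw [← Finset.sum_filter_add_sum_filter_not univ (fun S => j ∈ S)]
  -- the right sum: kill `j ∈ S` terms and expand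
  have hR : ∑ S : Finset σ, (if j ∈ S then 0 else c S + w * c (insert j S)) * ∏ i ∈ S, z i =
      ∑ S ∈ univ.filter (fun S => ¬ j ∈ S), (c S + w * c (insert j S)) * ∏ i ∈ S, z i := by
    rw [Finset.sum_filter]
    refine Finset.sum_congr rfl fun S _ => ?_
    by_cases h : j ∈ S <;> simp [h]
  rw [hR]
  have hprod_notMem : ∀ S : Finset σ, j ∉ S → ∏ i ∈ S, Function.update z j w i = ∏ i ∈ S, z i :=
    fun S hS => Finset.prod_congr rfl fun i hi => Function.update_of_ne (ne_of_mem_of_not_mem hi hS) w z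
  -- terms with `j ∉ S`
  have h1 : ∑ S ∈ univ.filter (fun S => ¬ j ∈ S), c S * ∏ i ∈ S, Function.update z j w i =
      ∑ S ∈ univ.filter (fun S => ¬ j ∈ S), c S * ∏ i ∈ S, z i := by
    refine Finset.sum_congr rfl fun S hS => ?_
    rw [Finset.mem_filter] at hS
    rw [hprod_notMem S hS.2]
  -- terms with `j ∈ S`: reindex `S = insert j U`, `U ∌ j`
  have h2 : ∑ S ∈ univ.filter (fun S => j ∈ S), c S * ∏ i ∈ S, Function.update z j w i =
      ∑ U ∈ univ.filter (fun U => ¬ j ∈ U), w * c (insert j U) * ∏ i ∈ U, z i := by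
    symm
    refine Finset.sum_nbij' (fun U => insert j U) (fun S => S.erase j) ?_ ?_ ?_ ?_ ?_
    · intro U hU
      simp only [mem_filter, mem_univ, true_and] at hU ⊢
      exact mem_insert_self j U
    · intro S hS
      simp only [mem_filter, mem_univ, true_and] at hS ⊢
      exact Finset.notMem_erase j S
    · intro U hU
      simp only [mem_filter, mem_univ, true_and] at hU
      exact erase_insert hU
    · intro S hS
      simp only [mem_filter, mem_univ, true_and] at hS
      exact insert_erase hS
    · intro U hU
      simp only [mem_filter, mem_univ, true_and] at hU
      rw [Finset.prod_insert hU, Function.update_self, hprod_notMem U hU]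
      ring
  rw [h1, h2, ← Finset.sum_add_distrib]
  refine Finset.sum_congr rfl fun S _ => ?_
  ring

/-- **Real specialisation keeps "stable or zero" (coefficient form, function language).** If the
real family `c` is identically zero or `Σ_S c(S) z^S` has no zero in `H^σ`, then the same holds
for the family `S ↦ [j ∉ S]·(c(S) + w·c(S ∪ j))` obtained by setting `z_j := w`, `w` real
(Wagner 2011, Lemma 2.4 (d): specialisation at a real point gives `0` or a stable polynomial).
[cite: Wagner2011, Lemma 2.4 (d)] -/
theorem multiAffine_stableOrZero_specialize (c : Finset σ → ℝ)
    (hc : (∀ S, c S = 0) ∨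
      ∀ z : σ → ℂ, (∀ i, 0 < (z i).im) → (∑ S : Finset σ, (c S : ℂ) * ∏ i ∈ S, z i) ≠ 0)
    (j : σ) (w : ℝ) :
    (∀ S, (if j ∈ S then 0 else c S + w * c (insert j S)) = 0) ∨
      ∀ z : σ → ℂ, (∀ i, 0 < (z i).im) →
        (∑ S : Finset σ, ((if j ∈ S then 0 else c S + w * c (insert j S) : ℝ) : ℂ) *
          ∏ i ∈ S, z i) ≠ 0 := by
  classical
  rcases hc with hc | hc
  · left
    intro S
    simp [hc]
  · have hP : IsUpperHalfPlaneStable (multiAffine fun S => (c S : ℂ)) :=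
      (isUpperHalfPlaneStable_multiAffine_iff _).2 hc
    have hspec := hP.specialize_real j w
    rw [bind₁_update_multiAffine] at hspec
    have hfam : (fun S => if j ∈ S then (0 : ℂ) else (c S : ℂ) + (w : ℂ) * (c (insert j S) : ℂ)) =
        fun S => (((if j ∈ S then 0 else c S + w * c (insert j S) : ℝ)) : ℂ) := by
      funext S
      by_cases h : j ∈ S <;> simp [h]
    rw [hfam] at hspec
    rcases hspec with h | h
    · left
      intro S
      have := (multiAffine_eq_zero_iff _).1 h S
      exact_mod_cast this
    · right
      exact (isUpperHalfPlaneStable_multiAffine_iff _).1 h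

/-- Specialising any list of variables at `1` keeps "identically zero or zero-free on `H^σ`".
[cite: Wagner2011, Lemma 2.4 (d)] -/
theorem multiAffine_stableOrZero_foldr_specializeOne (l : List σ) (c : Finset σ → ℝ)
    (hc : (∀ S, c S = 0) ∨
      ∀ z : σ → ℂ, (∀ i, 0 < (z i).im) → (∑ S : Finset σ, (c S : ℂ) * ∏ i ∈ S, z i) ≠ 0) :
    (∀ S, (l.foldr (fun j c' S => if j ∈ S then (0 : ℝ) else c' S + c' (insert j S)) c) S = 0) ∨
      ∀ z : σ → ℂ, (∀ i, 0 < (z i).im) →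
        (∑ S : Finset σ, ((l.foldr (fun j c' S => if j ∈ S then (0 : ℝ) else c' S + c' (insert j S)) c) S : ℂ) * ∏ i ∈ S, z i) ≠ 0 := by
  induction l with
  | nil => simpa using hc
  | cons j l ih =>
    have h := multiAffine_stableOrZero_specialize
      (l.foldr (fun j c' S => if j ∈ S then (0 : ℝ) else c' S + c' (insert j S)) c) ih j 1
    simp only [one_mul] at h
    rw [List.foldr_cons]
    exact h

omit [Fintype σ] in
/-- **Closed form of the iterated specialisation** (duplicate-free list `l`, `L = l.toFinset`):
the iterate of `c ↦ (S ↦ [j ∉ S](c S + c (S ∪ j)))` along `l` equals `S ↦ [S ∩ L = ∅] · Σ_{U ⊆ L} c(S ∪ U)`. [folklore] -/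
theorem foldr_specializeOne_apply (l : List σ) (hl : l.Nodup) (c : Finset σ → ℝ) (S : Finset σ) :
    (l.foldr (fun j c' S => if j ∈ S then (0 : ℝ) else c' S + c' (insert j S)) c) S =
      if Disjoint l.toFinset S then ∑ U ∈ l.toFinset.powerset, c (S ∪ U) else 0 := by
  classical
  induction l generalizing S with
  | nil => simp
  | cons j l ih =>
    have hjl : j ∉ l.toFinset := fun h => (List.nodup_cons.1 hl).1 (List.mem_toFinset.1 h)
    have hln : l.Nodup := (List.nodup_cons.1 hl).2
    rw [List.foldr_cons, List.toFinset_cons]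
    by_cases hjS : j ∈ S
    · rw [if_pos hjS, if_neg]
      exact fun h => Finset.disjoint_left.1 h (Finset.mem_insert_self j _) hjS
    · rw [if_neg hjS, ih hln S, ih hln (insert j S)]
      by_cases hd : Disjoint l.toFinset S
      · have hd' : Disjoint l.toFinset (insert j S) := Finset.disjoint_insert_right.2 ⟨hjl, hd⟩
        have hd'' : Disjoint (insert j l.toFinset) S := Finset.disjoint_insert_left.2 ⟨hjS, hd⟩
        rw [if_pos hd, if_pos hd', if_pos hd'', Finset.powerset_insert, Finset.sum_union]
        · congr 1
          rw [Finset.sum_image]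
          · refine Finset.sum_congr rfl fun U _ => ?_
            rw [Finset.insert_union, Finset.union_insert]
          · intro U hU U' hU' hUU'
            rw [Finset.mem_coe, Finset.mem_powerset] at hU hU'
            have hjU : j ∉ U := fun h => hjl (hU h)
            have hjU' : j ∉ U' := fun h => hjl (hU' h)
            rw [← Finset.erase_insert hjU, hUU', Finset.erase_insert hjU']
        · rw [Finset.disjoint_left]
          intro U hU hU'
          rw [Finset.mem_powerset] at hU
          rw [Finset.mem_image] at hU'
          obtain ⟨U', -, rfl⟩ := hU'
          exact hjl (hU (Finset.mem_insert_self j U'))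
      · have hd' : ¬ Disjoint l.toFinset (insert j S) :=
          fun h => hd (Finset.disjoint_of_subset_right (Finset.subset_insert j S) h)
        have hd'' : ¬ Disjoint (insert j l.toFinset) S :=
          fun h => hd (Finset.disjoint_of_subset_left (Finset.subset_insert j _) h)
        rw [if_neg hd, if_neg hd', if_neg hd'', add_zero]

/-- Reindexing the marginal classes: for `A ⊆ {x,y}`, `Σ_{U ⊆ σ∖{x,y}} c(A ∪ U) = Σ_{S : S ∩ {x,y} = A} c(S)`.
[folklore] -/
theorem sum_powerset_compl_pair (c : Finset σ → ℝ) (x y : σ) (A : Finset σ) (hA : A ⊆ {x, y}) :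
    ∑ U ∈ ((univ : Finset σ) \ {x, y}).powerset, c (A ∪ U) =
      ∑ S ∈ univ.filter (fun S : Finset σ => S ∩ {x, y} = A), c S := by
  classical
  refine Finset.sum_nbij' (fun U => A ∪ U) (fun S => S \ {x, y}) ?_ ?_ ?_ ?_ ?_
  · intro U hU
    rw [Finset.mem_powerset] at hU
    simp only [mem_filter, mem_univ, true_and]
    ext i
    simp only [Finset.mem_inter, Finset.mem_union]
    constructor
    · rintro ⟨hi | hi, hixy⟩
      · exact hi
      · exact absurd hixy (Finset.mem_sdiff.1 (hU hi)).2
    · intro hi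
      exact ⟨Or.inl hi, hA hi⟩
  · intro S _
    rw [Finset.mem_powerset]
    exact Finset.sdiff_subset_sdiff (Finset.subset_univ S) le_rfl
  · intro U hU
    rw [Finset.mem_powerset] at hU
    ext i
    simp only [Finset.mem_sdiff, Finset.mem_union]
    constructor
    · rintro ⟨hi | hi, hixy⟩
      · exact absurd (hA hi) hixy
      · exact hi
    · intro hi
      exact ⟨Or.inr hi, (Finset.mem_sdiff.1 (hU hi)).2⟩
  · intro S hS
    simp only [mem_filter, mem_univ, true_and] at hS
    ext i
    simp only [Finset.mem_union, Finset.mem_sdiff]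
    constructor
    · rintro (hi | ⟨hi, -⟩)
      · rw [← hS] at hi
        exact (Finset.mem_inter.1 hi).1
      · exact hi
    · intro hi
      by_cases hixy : i ∈ ({x, y} : Finset σ)
      · left
        rw [← hS]
        exact Finset.mem_inter.2 ⟨hi, hixy⟩
      · right
        exact ⟨hi, hixy⟩
  · intro U _
    rfl

/-- **Two-by-two negative lattice condition for the MARGINAL table of two sites**: if the real
family `c` is identically zero or `Σ_S c(S) z^S` is zero-free on `H^σ`, then with
`m(A) := Σ_{S : S ∩ {x,y} = A} c(S)` one has `m(∅) · m({x,y}) ≤ m({x}) · m({y})` for `x ≠ y`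
(specialise every other variable at `1`, which keeps "stable or zero", and apply
`multiAffine_twoByTwo_nlc`). No sign assumption on `c`. [cite: BorceaBrandenLiggett2007, §2.1 and §4.1] -/
theorem multiAffine_marginal_nlc (c : Finset σ → ℝ)
    (hc : (∀ S, c S = 0) ∨
      ∀ z : σ → ℂ, (∀ i, 0 < (z i).im) → (∑ S : Finset σ, (c S : ℂ) * ∏ i ∈ S, z i) ≠ 0)
    {x y : σ} (hxy : x ≠ y) :
    (∑ S ∈ univ.filter (fun S : Finset σ => S ∩ {x, y} = ∅), c S) *
        (∑ S ∈ univ.filter (fun S : Finset σ => S ∩ {x, y} = {x, y}), c S) ≤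
      (∑ S ∈ univ.filter (fun S : Finset σ => S ∩ {x, y} = {x}), c S) *
        (∑ S ∈ univ.filter (fun S : Finset σ => S ∩ {x, y} = {y}), c S) := by
  classical
  set l := (((univ : Finset σ) \ {x, y})).toList with hl
  have hln : l.Nodup := Finset.nodup_toList _
  have hlL : l.toFinset = (univ : Finset σ) \ {x, y} := Finset.toList_toFinset _
  have hb := multiAffine_stableOrZero_foldr_specializeOne l c hc
  have key := multiAffine_twoByTwo_nlc _ hxy hb
  have happly : ∀ A : Finset σ, A ⊆ {x, y} →
      (l.foldr (fun j c' S => if j ∈ S then (0 : ℝ) else c' S + c' (insert j S)) c) A =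
        ∑ S ∈ univ.filter (fun S : Finset σ => S ∩ {x, y} = A), c S := by
    intro A hA
    rw [foldr_specializeOne_apply l hln c A, hlL, if_pos, sum_powerset_compl_pair c x y A hA]
    exact Finset.disjoint_of_subset_right hA Finset.sdiff_disjoint
  rw [happly ∅ (Finset.empty_subset _), happly {x, y} le_rfl,
    happly {x} (Finset.singleton_subset_iff.2 (Finset.mem_insert_self x {y})),
    happly {y} (Finset.singleton_subset_iff.2 (by simp))] at key
  exact key

/-- **Pairwise negative correlation** (Borcea–Brändén–Liggett: strongly Rayleigh ⇒ negatively
correlated pairs), unnormalised form for a real coefficient family `c` that is identically zero or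
whose generating polynomial is zero-free on `H^σ`:
`(Σ_{S ∋ x,y} c) · (Σ_S c) ≤ (Σ_{S ∋ x} c) · (Σ_{S ∋ y} c)` for `x ≠ y` (equivalent to the marginal
two-by-two negative lattice condition: `D(A+B+C+D) ≤ (B+D)(C+D) ⟺ AD ≤ BC`). No sign assumption.
[cite: BorceaBrandenLiggett2007, §2.1 and §4.1] -/
theorem multiAffine_pairwise_negCorr (c : Finset σ → ℝ)
    (hc : (∀ S, c S = 0) ∨
      ∀ z : σ → ℂ, (∀ i, 0 < (z i).im) → (∑ S : Finset σ, (c S : ℂ) * ∏ i ∈ S, z i) ≠ 0)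
    {x y : σ} (hxy : x ≠ y) :
    (∑ S ∈ univ.filter (fun S : Finset σ => x ∈ S ∧ y ∈ S), c S) * (∑ S, c S) ≤
      (∑ S ∈ univ.filter (fun S : Finset σ => x ∈ S), c S) *
        (∑ S ∈ univ.filter (fun S : Finset σ => y ∈ S), c S) := by
  classical
  have key := multiAffine_marginal_nlc c hc hxy
  -- the four marginal classes
  set A := ∑ S ∈ univ.filter (fun S : Finset σ => S ∩ {x, y} = ∅), c S with hA
  set B := ∑ S ∈ univ.filter (fun S : Finset σ => S ∩ {x, y} = {x}), c S with hB
  set C := ∑ S ∈ univ.filter (fun S : Finset σ => S ∩ {x, y} = {y}), c S with hC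
  set D := ∑ S ∈ univ.filter (fun S : Finset σ => S ∩ {x, y} = {x, y}), c S with hD
  -- membership descriptions of the classes
  have hcl : ∀ S : Finset σ,
      (S ∩ {x, y} = ∅ ↔ (x ∉ S ∧ y ∉ S)) ∧ (S ∩ {x, y} = {x} ↔ (x ∈ S ∧ y ∉ S)) ∧
      (S ∩ {x, y} = {y} ↔ (x ∉ S ∧ y ∈ S)) ∧ (S ∩ {x, y} = {x, y} ↔ (x ∈ S ∧ y ∈ S)) := by
    intro S
    refine ⟨?_, ?_, ?_, ?_⟩
    · rw [Finset.eq_empty_iff_forall_notMem]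
      constructor
      · intro h
        exact ⟨fun hx => h x (by simp [hx]), fun hy => h y (by simp [hy])⟩
      · rintro ⟨hx, hy⟩ i hi
        simp only [Finset.mem_inter, Finset.mem_insert, Finset.mem_singleton] at hi
        rcases hi with ⟨hi, rfl | rfl⟩
        · exact hx hi
        · exact hy hi
    · constructor
      · intro h
        refine ⟨?_, fun hy => ?_⟩
        · have : x ∈ S ∩ {x, y} := by rw [h]; simp
          exact (Finset.mem_inter.1 this).1
        · have : y ∈ S ∩ {x, y} := Finset.mem_inter.2 ⟨hy, by simp⟩
          rw [h, Finset.mem_singleton] at this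
          exact hxy this.symm
      · rintro ⟨hx, hy⟩
        ext i
        simp only [Finset.mem_inter, Finset.mem_insert, Finset.mem_singleton]
        constructor
        · rintro ⟨hi, rfl | rfl⟩
          · rfl
          · exact absurd hi hy
        · rintro rfl
          exact ⟨hx, Or.inl rfl⟩
    · constructor
      · intro h
        refine ⟨fun hx => ?_, ?_⟩
        · have : x ∈ S ∩ {x, y} := Finset.mem_inter.2 ⟨hx, by simp⟩
          rw [h, Finset.mem_singleton] at this
          exact hxy this
        · have : y ∈ S ∩ {x, y} := by rw [h]; simp
          exact (Finset.mem_inter.1 this).1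
      · rintro ⟨hx, hy⟩
        ext i
        simp only [Finset.mem_inter, Finset.mem_insert, Finset.mem_singleton]
        constructor
        · rintro ⟨hi, rfl | rfl⟩
          · exact absurd hi hx
          · rfl
        · rintro rfl
          exact ⟨hy, Or.inr rfl⟩
    · constructor
      · intro h
        have hx : x ∈ S ∩ {x, y} := by rw [h]; simp
        have hy : y ∈ S ∩ {x, y} := by rw [h]; simp
        exact ⟨(Finset.mem_inter.1 hx).1, (Finset.mem_inter.1 hy).1⟩
      · rintro ⟨hx, hy⟩
        ext i
        simp only [Finset.mem_inter, Finset.mem_insert, Finset.mem_singleton]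
        constructor
        · rintro ⟨-, h⟩
          exact h
        · rintro (rfl | rfl)
          · exact ⟨hx, Or.inl rfl⟩
          · exact ⟨hy, Or.inr rfl⟩
  -- name the four classes and identify the membership filters with them
  have eXY : (∑ S ∈ univ.filter (fun S : Finset σ => x ∈ S ∧ y ∈ S), c S) =
      ∑ S ∈ univ.filter (fun S : Finset σ => S ∩ {x, y} = {x, y}), c S :=
    Finset.sum_congr (Finset.filter_congr fun S _ => ((hcl S).2.2.2).symm) fun _ _ => rfl
  have eX : (∑ S ∈ univ.filter (fun S : Finset σ => x ∈ S ∧ ¬ y ∈ S), c S) =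
      ∑ S ∈ univ.filter (fun S : Finset σ => S ∩ {x, y} = {x}), c S :=
    Finset.sum_congr (Finset.filter_congr fun S _ => ((hcl S).2.1).symm) fun _ _ => rfl
  have eY : (∑ S ∈ univ.filter (fun S : Finset σ => ¬ x ∈ S ∧ y ∈ S), c S) =
      ∑ S ∈ univ.filter (fun S : Finset σ => S ∩ {x, y} = {y}), c S :=
    Finset.sum_congr (Finset.filter_congr fun S _ => ((hcl S).2.2.1).symm) fun _ _ => rfl
  have eE : (∑ S ∈ univ.filter (fun S : Finset σ => ¬ x ∈ S ∧ ¬ y ∈ S), c S) =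
      ∑ S ∈ univ.filter (fun S : Finset σ => S ∩ {x, y} = ∅), c S :=
    Finset.sum_congr (Finset.filter_congr fun S _ => ((hcl S).1).symm) fun _ _ => rfl
  -- splitting sums along a second predicate
  have hsplit : ∀ (p q : Finset σ → Prop) [DecidablePred p] [DecidablePred q],
      (∑ S ∈ univ.filter p, c S) =
        (∑ S ∈ univ.filter (fun S => p S ∧ q S), c S) + ∑ S ∈ univ.filter (fun S => p S ∧ ¬ q S), c S := by
    intro p q _ _
    rw [← Finset.sum_filter_add_sum_filter_not (univ.filter p) q, Finset.filter_filter,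
      Finset.filter_filter]
  have hX : (∑ S ∈ univ.filter (fun S : Finset σ => x ∈ S), c S) =
      (∑ S ∈ univ.filter (fun S : Finset σ => x ∈ S ∧ y ∈ S), c S) +
        ∑ S ∈ univ.filter (fun S : Finset σ => x ∈ S ∧ ¬ y ∈ S), c S :=
    hsplit (fun S => x ∈ S) (fun S => y ∈ S)
  have hY : (∑ S ∈ univ.filter (fun S : Finset σ => y ∈ S), c S) =
      (∑ S ∈ univ.filter (fun S : Finset σ => x ∈ S ∧ y ∈ S), c S) +
        ∑ S ∈ univ.filter (fun S : Finset σ => ¬ x ∈ S ∧ y ∈ S), c S := by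
    rw [hsplit (fun S => y ∈ S) (fun S => x ∈ S)]
    congr 1
    · exact Finset.sum_congr (Finset.filter_congr fun S _ => and_comm) fun _ _ => rfl
    · exact Finset.sum_congr (Finset.filter_congr fun S _ => and_comm) fun _ _ => rfl
  have hZ : (∑ S, c S) = (∑ S ∈ univ.filter (fun S : Finset σ => x ∈ S), c S) +
      ((∑ S ∈ univ.filter (fun S : Finset σ => ¬ x ∈ S ∧ y ∈ S), c S) +
        ∑ S ∈ univ.filter (fun S : Finset σ => ¬ x ∈ S ∧ ¬ y ∈ S), c S) := by
    rw [← Finset.sum_filter_add_sum_filter_not univ (fun S : Finset σ => x ∈ S),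
      hsplit (fun S : Finset σ => ¬ x ∈ S) (fun S => y ∈ S)]
  rw [hZ, hX, hY, eXY, eX, eY, eE]
  rw [eXY, eX, eY, eE] at *
  nlinarith [key]

end Literature.Combinatorics.StablePolynomials

end
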